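import Mathlib
import Summits.ValiantsHypothesis.ValiantsHypothesis.Theorems.BorderApolarityFixedWitnessObstructionQPSocle

/-!
# Border apolarity, crux `FixedWitnessObstructionQP` — the EXTREMAL socle step (line `toric-face-debordering`)

Route `ValiantsHypothesis/BorderApolarity`, crux item `stmt-ValiantsHypothesis-5778`, line
`toric-face-debordering`, stub `stub_socleMax`.  This is the socle step `stub_socle`
(`…BorderApolarityFixedWitnessObstructionQPSocle`) with its conclusion strengthened by the
EXTREMALITY clause: if `J` is the border-apolar limit of the toric family
`Q_t = u · diag((t+2)^w) · g · det_m` (only the limsup clause W3 in degree `m` is used) and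
`J_m ⌟ pp = 0` for the padded permanent `pp = X₀₀^{m-n} per_n` (W5 in degree `m`), then
`pp = u · wHC_{w'}^{e'}(g' · det_m)` for some `g' ∈ GL_{m²}`, ℕ-valued weights `w'` and a level
`e'` which is the MAXIMAL `w'`-weight of a monomial of `g' · det_m`; i.e. the component is the
initial form (top toric face) of `g' · det_m`, a genuine toric limit of a translate of `det_m`.
Without extremality the conclusion is cheap for `m ≥ 2n - 1` (middle weight slices of translates
of `det_m` represent padded permanents), so the line exports the extremal form.

Proof.  Verbatim the socle step: with `F = g · det_m`, `e₀ = max_{d ∈ supp F} ⟨w,d⟩` and the top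
component `F₀`, `(t+2)^{-e₀} Q_t → u · F₀` coefficientwise (`Socle.tendsto_coeffVec_torus`),
`Ann_m(u · F₀) ⊆ J m ⊆ Ann_m(pp)` (`Socle.mem_of_apolarAction_limit_eq_zero`, W3, W5), so
`pp = μ • u · F₀` (`Socle.exists_eq_smul_of_apolar_imp`), `μ ≠ 0`, `μ F = g' · det_m`
(`BorderApolarity.smul_mem_glOrbit_detPoly`), and `F₀ = wHC_{w'}^{e'}(μ F)` for the shifted weights
`w' = w - min w ≥ 0`, `e' = e₀ - m · min w` (`F` is a form of degree `m`).  The level `e₀` was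
CHOSEN as the maximal weight on `supp F = supp (μ F)`, and the shift is monotone, whence
extremality.
Sources: Buczyńska–Buczyński 2021 Thm 1 (necessity half, socle degree); Landsberg 2017 §6.7.
-/

open MvPolynomial Filter
open scoped BigOperators Matrix Topology
open Literature.Computability.AlgebraicComplexity

-- the mandated summit-side namespace `Summit.ValiantsHypothesis.ValiantsHypothesis.…`
-- (single-problem summit: summit name = problem name) repeats a component by design
set_option linter.dupNamespace false

namespace Summit.ValiantsHypothesis.ValiantsHypothesis.Theorems.BorderApolarityFixedWitnessObstructionQP

namespace SocleMax

noncomputable section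

/-- **The extremal socle step** (`apolarAction` form).  For `n ≤ m`, let
`Q t = u · diag((t+2)^w) · g · det_m` be a toric family (`w : variables → ℤ`).  If `J m` contains
every subsequential coefficientwise limit of degree-`m` annihilators of the `Q t` (W3 at `k = m`)
and `J m ⌟ pp = 0` (W5 at `k = m`), then `pp = u · wHC_{w'}^{e'}(g' · det_m)` with ℕ-valued
weights `w'` and `e'` the maximal `w'`-weight of a monomial of `g' · det_m` (so the component is
the initial form of `g' · det_m` for `w'`). [folklore] -/
theorem exists_eq_weightedHomogeneousComponent_max {n m : ℕ} [NeZero m] (hnm : n ≤ m)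
    (J : ℕ → Set (MvPolynomial (Fin m × Fin m) ℂ))
    (u g : Matrix.GeneralLinearGroup (Fin m × Fin m) ℂ) (w : Fin m × Fin m → ℤ)
    (Q : ℕ → MvPolynomial (Fin m × Fin m) ℂ)
    (hQ : ∀ t : ℕ, Q t = linSubst (Fin m × Fin m) ℂ (u : Matrix (Fin m × Fin m) (Fin m × Fin m) ℂ)
      (linSubst (Fin m × Fin m) ℂ (Matrix.diagonal fun i : Fin m × Fin m => ((t : ℂ) + 2) ^ (w i))
        (linSubst (Fin m × Fin m) ℂ (g : Matrix (Fin m × Fin m) (Fin m × Fin m) ℂ)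
          (detPoly (Fin m) ℂ))))
    (hW3 : ∀ (D : MvPolynomial (Fin m × Fin m) ℂ) (φ : ℕ → ℕ)
      (Ds : ℕ → MvPolynomial (Fin m × Fin m) ℂ), StrictMono φ →
      (∀ t, (Ds t).IsHomogeneous m ∧ apolarAction (Ds t) (Q (φ t)) = 0) →
      Tendsto (fun t => coeffVec (Ds t)) atTop (𝓝 (coeffVec D)) → D ∈ J m)
    (hW5 : ∀ D ∈ J m, apolarAction D (paddedPerPoly ℂ n m) = 0) :
    ∃ (u' g' : Matrix.GeneralLinearGroup (Fin m × Fin m) ℂ) (w' : Fin m × Fin m → ℕ) (e : ℕ),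
      (∀ d ∈ (linSubst (Fin m × Fin m) ℂ (g' : Matrix (Fin m × Fin m) (Fin m × Fin m) ℂ)
        (detPoly (Fin m) ℂ)).support, Finsupp.weight w' d ≤ e) ∧
      paddedPerPoly ℂ n m =
        linSubst (Fin m × Fin m) ℂ (u' : Matrix (Fin m × Fin m) (Fin m × Fin m) ℂ)
          (MvPolynomial.weightedHomogeneousComponent w' e
            (linSubst (Fin m × Fin m) ℂ (g' : Matrix (Fin m × Fin m) (Fin m × Fin m) ℂ)
              (detPoly (Fin m) ℂ))) := by
  -- `F = g · det_m`: a nonzero form of degree `m` in the orbit of `det_m`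
  set F : MvPolynomial (Fin m × Fin m) ℂ := linSubst (Fin m × Fin m) ℂ
    (g : Matrix (Fin m × Fin m) (Fin m × Fin m) ℂ) (detPoly (Fin m) ℂ) with hF
  have hForb : F ∈ glOrbit (Fin m × Fin m) ℂ (detPoly (Fin m) ℂ) := ⟨g, linSubstRep_apply _ _ g _⟩
  have hFne : F ≠ 0 := BorderApolarity.ne_zero_of_mem_glOrbit_detPoly hForb
  have hFhom : F.IsHomogeneous m := by
    simpa [Fintype.card_fin] using BorderApolarity.isHomogeneous_of_mem_glOrbit_detPoly hForb
  have hdeg : ∀ d ∈ F.support, ∑ i ∈ d.support, (d i : ℤ) = m := fun d hd => by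
    have h : d.degree = m := by
      rw [Finsupp.degree_eq_weight_one]; exact hFhom (mem_support_iff.1 hd)
    rw [Finsupp.degree_apply] at h
    exact_mod_cast h
  -- the top weight `e₀` (MAXIMAL on the support) and the top weight component `F₀ ≠ 0` of `F`
  obtain ⟨d₀, hd₀, hmax⟩ := Finset.exists_max_image F.support (Finsupp.weight w)
    (support_nonempty.2 hFne)
  set e₀ : ℤ := Finsupp.weight w d₀ with he₀
  set F₀ : MvPolynomial (Fin m × Fin m) ℂ := ∑ d ∈ F.support,
    monomial d (if Finsupp.weight w d = e₀ then coeff d F else 0) with hF₀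
  have hF₀coeff : ∀ d, coeff d F₀ =
      if Finsupp.weight w d = e₀ then coeff d F else 0 := by
    intro d
    rw [hF₀, coeff_sum, Finset.sum_eq_single d (fun e _ hne => by rw [coeff_monomial, if_neg hne])
      (fun hd => by rw [coeff_monomial, if_pos rfl, notMem_support_iff.1 hd, ite_self]),
      coeff_monomial, if_pos rfl]
  have hF₀ne : F₀ ≠ 0 := by
    intro h
    have h0 := hF₀coeff d₀
    rw [h, coeff_zero, if_pos rfl] at h0
    exact (mem_support_iff.1 hd₀) h0.symm
  have hF₀hom : F₀.IsHomogeneous m := by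
    intro d hd
    rw [hF₀coeff] at hd
    split_ifs at hd with h
    · exact hFhom hd
    · exact absurd rfl hd
  -- the limit direction `Q_∞ = u · F₀ ≠ 0`, a form of degree `m`
  have hQinfne : linSubst (Fin m × Fin m) ℂ (u : Matrix (Fin m × Fin m) (Fin m × Fin m) ℂ) F₀ ≠ 0 :=
    fun h => hF₀ne (linSubst_injective_of_isUnit_det _ (Matrix.isUnits_det_units u)
      (h.trans (map_zero _).symm))
  have hQinfhom : (linSubst (Fin m × Fin m) ℂ (u : Matrix (Fin m × Fin m) (Fin m × Fin m) ℂ)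
      F₀).IsHomogeneous m := linSubst_isHomogeneous _ hF₀hom
  have hQhom : ∀ t, (Q t).IsHomogeneous m := fun t => by
    rw [hQ]; exact linSubst_isHomogeneous _ (linSubst_isHomogeneous _ hFhom)
  -- `(t+2)^{-e₀} • Q t → Q_∞` coefficientwise
  have hlim : Tendsto (fun t : ℕ => coeffVec ((((t : ℂ) + 2) ^ (-e₀)) • Q t)) atTop
      (𝓝 (coeffVec (linSubst (Fin m × Fin m) ℂ
        (u : Matrix (Fin m × Fin m) (Fin m × Fin m) ℂ) F₀))) := by
    simp_rw [hQ]
    exact Socle.tendsto_coeffVec_torus _ F w hmax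
  -- `Ann_m(Q_∞) ⊆ J m ⊆ Ann_m(pp)`, so `pp = μ • Q_∞` with `μ ≠ 0`
  have key : ∀ D : MvPolynomial (Fin m × Fin m) ℂ, D.IsHomogeneous m →
      apolarAction D (linSubst (Fin m × Fin m) ℂ
        (u : Matrix (Fin m × Fin m) (Fin m × Fin m) ℂ) F₀) = 0 → D ∈ J m :=
    fun D hD hDQ => Socle.mem_of_apolarAction_limit_eq_zero hQhom hW3
      (r := fun t : ℕ => ((t : ℂ) + 2) ^ (-e₀))
      (fun t => zpow_ne_zero _ (BorderApolarityToricFixedPoints.tli_natCast_add_two_ne_zero t))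
      hQinfhom hQinfne hlim hD hDQ
  obtain ⟨μ, hμ⟩ := Socle.exists_eq_smul_of_apolar_imp hQinfhom hQinfne
    (paddedPerPoly_isHomogeneous (k := ℂ) hnm) fun D hD hDQ => hW5 D (key D hD hDQ)
  have hμne : μ ≠ 0 := by
    rintro rfl
    rw [zero_smul] at hμ
    exact BorderApolarity.paddedPerPoly_ne_zero n m hμ
  -- repackage: `μ • F = g' · det_m`, and shift the weights to `ℕ`
  obtain ⟨g', hg'⟩ := BorderApolarity.smul_mem_glOrbit_detPoly hForb hμne
  have hg'' : linSubstRep (Fin m × Fin m) ℂ g' (detPoly (Fin m) ℂ) = μ • F := hg'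
  rw [linSubstRep_apply] at hg''
  obtain ⟨i₀, -, hi₀⟩ := Finset.exists_min_image (Finset.univ : Finset (Fin m × Fin m)) w
    Finset.univ_nonempty
  have hw' : ∀ i, (((w i - w i₀).toNat : ℕ) : ℤ) = w i - w i₀ := fun i =>
    Int.toNat_of_nonneg (sub_nonneg.2 (hi₀ i (Finset.mem_univ i)))
  have he₀ge : (m : ℤ) * w i₀ ≤ e₀ := by
    rw [he₀, Finsupp.weight_apply, Finsupp.sum]
    calc (m : ℤ) * w i₀ = ∑ i ∈ d₀.support, (d₀ i : ℤ) * w i₀ := by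
          rw [← Finset.sum_mul, hdeg d₀ hd₀]
      _ ≤ ∑ i ∈ d₀.support, d₀ i • w i := Finset.sum_le_sum fun i _ => by
          rw [nsmul_eq_mul]
          exact mul_le_mul_of_nonneg_left (hi₀ i (Finset.mem_univ i)) (Nat.cast_nonneg _)
  have he' : (((e₀ - m * w i₀).toNat : ℕ) : ℤ) = e₀ - m * w i₀ :=
    Int.toNat_of_nonneg (sub_nonneg.2 he₀ge)
  -- the shifted weight of a degree-`m` monomial is the old weight shifted by `m · min w`
  have hwt : ∀ d ∈ F.support, ((Finsupp.weight (fun i => (w i - w i₀).toNat) d : ℕ) : ℤ) =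
      Finsupp.weight w d - m * w i₀ := fun d hd => by
    rw [Finsupp.weight_apply, Finsupp.weight_apply, Finsupp.sum, Finsupp.sum]
    simp only [smul_eq_mul, nsmul_eq_mul, Nat.cast_sum, Nat.cast_mul, hw']
    rw [← hdeg d hd, Finset.sum_mul, ← Finset.sum_sub_distrib]
    exact Finset.sum_congr rfl fun i _ => by ring
  have hwhc : weightedHomogeneousComponent (fun i => (w i - w i₀).toNat) (e₀ - m * w i₀).toNat F =
      F₀ := by
    ext d
    rw [coeff_weightedHomogeneousComponent, hF₀coeff]
    by_cases hd : d ∈ F.support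
    · have hiff : Finsupp.weight (fun i => (w i - w i₀).toNat) d = (e₀ - m * w i₀).toNat ↔
          Finsupp.weight w d = e₀ := by
        rw [← Nat.cast_inj (R := ℤ), hwt d hd, he', sub_left_inj]
      by_cases h : Finsupp.weight w d = e₀
      · rw [if_pos h, if_pos (hiff.2 h)]
      · rw [if_neg h, if_neg (mt hiff.1 h)]
    · rw [notMem_support_iff.1 hd, ite_self, ite_self]
  refine ⟨u, g', fun i => (w i - w i₀).toNat, (e₀ - m * w i₀).toNat, ?_, ?_⟩
  · -- extremality: `supp (g' · det_m) = supp (μ • F) ⊆ supp F`, on which `⟨w,d⟩ ≤ e₀` (`hmax`)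
    intro d hd
    rw [hg''] at hd
    have hdF : d ∈ F.support := by
      rw [mem_support_iff] at hd ⊢
      rw [coeff_smul, smul_eq_mul] at hd
      exact right_ne_zero_of_mul hd
    rw [← Nat.cast_le (α := ℤ), hwt d hdF, he']
    exact sub_le_sub_right (hmax d hdF) _
  · rw [hg'', map_smul, map_smul, hwhc]
    exact hμ

end

end SocleMax

/-- **Stub 1b⁺ — the EXTREMAL SOCLE STEP** of line `toric-face-debordering` (crux
`FixedWitnessObstructionQP`, stmt-ValiantsHypothesis-5778).  If `J` is the border-apolar limit
(W2 ∧ W3, `k ≤ m`) of the TORIC family `Q_t = u · diag((t+2)^w) · g · det_m`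
(`w : variables → ℤ`; the conclusion of route item `ToricFixedPoints`, stmt-5779, verbatim) and
`J_k ⊆ Ann_k(pp)` for `k ≤ m` (W5), then the padded permanent `pp = X₀₀^{m-n} per_n` is a
translate of the INITIAL FORM `wHC_w^e(g · det_m)`, `e = max` of the `w`-weights on
`supp (g · det_m)`, of a translate of the determinant, with ℕ-valued weights `w`.  Only W3 and W5
at `k = m` are used (`SocleMax.exists_eq_weightedHomogeneousComponent_max`; the inline `act` is
`apolarAction` by `rfl`).  Strengthens `stub_socle` by the extremality conjunct.
Sources: Buczyńska–Buczyński 2021 Thm 1 (necessity half, socle degree); Landsberg 2017 §6.7.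
[folklore] -/
theorem stub_socleMax : ∀ (n m : ℕ) [NeZero m], 3 ≤ n → n ≤ m → let act := fun (D f : MvPolynomial (Fin m × Fin m) ℂ) => ∑ e ∈ D.support, ∑ d ∈ f.support, MvPolynomial.monomial (d - e) (MvPolynomial.coeff e D * MvPolynomial.coeff d f * ∏ i ∈ e.support, (Nat.descFactorial (d i) (e i) : ℂ));
    ∀ (J : ℕ → Set (MvPolynomial (Fin m × Fin m) ℂ)) (u g : Matrix.GeneralLinearGroup (Fin m × Fin m) ℂ)
      (w : Fin m × Fin m → ℤ),
      (let Q : ℕ → MvPolynomial (Fin m × Fin m) ℂ := fun t => Literature.Computability.AlgebraicComplexity.linSubst (Fin m × Fin m) ℂ (u : Matrix (Fin m × Fin m) (Fin m × Fin m) ℂ) (Literature.Computability.AlgebraicComplexity.linSubst (Fin m × Fin m) ℂ (Matrix.diagonal fun i : Fin m × Fin m => ((t : ℂ) + 2) ^ (w i)) (Literature.Computability.AlgebraicComplexity.linSubst (Fin m × Fin m) ℂ (g : Matrix (Fin m × Fin m) (Fin m × Fin m) ℂ) (Literature.Computability.AlgebraicComplexity.detPoly (Fin m) ℂ))); (∀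 k ≤ m, ∀ D ∈ J k, ∃ Ds : ℕ → MvPolynomial (Fin m × Fin m) ℂ, (∀ t, (Ds t).IsHomogeneous k ∧ act (Ds t) (Q t) = 0) ∧ Filter.Tendsto (fun t => Literature.Computability.AlgebraicComplexity.coeffVec (Ds t)) Filter.atTop (nhds (Literature.Computability.AlgebraicComplexity.coeffVec D))) ∧ (∀ k ≤ m, ∀ (D : MvPolynomial (Fin m × Fin m) ℂ) (φ : ℕ → ℕ) (Ds : ℕ → MvPolynomial (Fin m × Fin m) ℂ), StrictMono φ → (∀ t, (Ds t).IsHomogeneous k ∧ act (Ds t) (Q (φ t)) = 0) → Filter.Tendsto (fun t => Literature.Computability.AlgebraicComplexity.coeffVec (Ds t)) Filter.atTop (nhds (Literature.Computability.AlgebraicComplexity.coeffVec D)) → D ∈ J k)) →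
      (∀ k ≤ m, ∀ D ∈ J k, act D (Literature.Computability.AlgebraicComplexity.paddedPerPoly ℂ n m) = 0) →
      ∃ (u g : Matrix.GeneralLinearGroup (Fin m × Fin m) ℂ) (w : Fin m × Fin m → ℕ) (e : ℕ),
        (∀ d ∈ (linSubst (Fin m × Fin m) ℂ (g : Matrix (Fin m × Fin m) (Fin m × Fin m) ℂ) (detPoly (Fin m) ℂ)).support,
          Finsupp.weight w d ≤ e) ∧
        paddedPerPoly ℂ n m =
          linSubst (Fin m × Fin m) ℂ (u : Matrix (Fin m × Fin m) (Fin m × Fin m) ℂ)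
            (MvPolynomial.weightedHomogeneousComponent w e
              (linSubst (Fin m × Fin m) ℂ (g : Matrix (Fin m × Fin m) (Fin m × Fin m) ℂ) (detPoly (Fin m) ℂ))) := by
  intro n m _ _ hnm
  dsimp only
  intro J u g w hQ hW5
  exact SocleMax.exists_eq_weightedHomogeneousComponent_max hnm J u g w _ (fun t => rfl)
    (hQ.2 m le_rfl) (hW5 m le_rfl)

end Summit.ValiantsHypothesis.ValiantsHypothesis.Theorems.BorderApolarityFixedWitnessObstructionQP
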